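import Summits.HodgeConjecture.HodgeConjecture.Theorems.NikulinTwinTransportRealMultiplicationTwoSimilitudeOfUnimodular
import Summits.HodgeConjecture.HodgeConjecture.Theorems.NikulinTwinTransportRealMultiplicationIntegralBasis
import Summits.HodgeConjecture.HodgeConjecture.Theorems.NikulinTwinTransportRealMultiplicationGForm
import Summits.HodgeConjecture.HodgeConjecture.Theorems.NikulinTwinTransportRealMultiplicationOfTwoSelfSimilar
import Summits.HodgeConjecture.HodgeConjecture.Theorems.NikulinTwinTransportRealMultiplicationGlueOfTwoSelfSimilar
import Literature.AlgebraicGeometry.Surfaces.K3LatticeInvariants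

/-!
# Route NikulinTwinTransport · `RealMultiplicationSqrtTwoAlgebraic` (stmt-HodgeConjecture-13679) —
# the item from X and the PARITY of `b₂` alone (hence from X + `K3_finrank_complexBetti_two`)

Helper file (supports stmt-HodgeConjecture-13679). State of the item before this file: the route
decl `RealMultiplicationSqrtTwoAlgebraic` (real multiplication by `√2` on the transcendental part of
`H²` of a projective K3 surface is algebraic — standalone an open sub-case of the Hodge conjecture,
van Geemen–Schütt, arXiv:2310.05196 Rem. 4.9) is derived in the tree from X =
`TwinSimilitudeAlgebraic` (stmt-HodgeConjecture-13674, used at the pairs `(S, S)` only) plus ONE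
topological input, a rational `2`-self-similitude of `(H²(S(ℂ); ℚ), ∪)`
(`realMultiplicationSqrtTwoAlgebraic_of_twinSimilitude_of_twoSelfSimilar`, seat 13679-3), which so
far came from the marking fact (`…_of_twinSimilitude_of_marking`) or from the three numerical facts
`b₂ = 22`, even intersection form, index `−16` (`…_of_twinSimilitude_of_k3Invariants`, seat
13679-c1-0, through Milnor's theorem).

This file shows that the PARITY OF `b₂` is the only topological input needed:

* `twoSelfSimilar_of_even_finrank` — for EVERY smooth projective surface `S` over `ℂ` with
  `dim_ℂ H²(S(ℂ); ℂ)` even there is a `ℂ`-linear `Ξ` of `H²(S(ℂ); ℂ)` preserving rational classes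
  with `(Ξx ∪ Ξy) = 2 (x ∪ y)`. Proof: the cup form on `H²(S(ℂ); ℤ)/T` is symmetric unimodular
  (Poincaré duality; the tree's `exists_integralMarking`, seat 13681-2), and every unimodular
  lattice of even rank has a rational `2`-self-similitude (sibling file
  `NikulinTwinTransportRealMultiplicationTwoSimilitudeOfUnimodular`: Serre's Thm. 4 for
  `G ⊕ ⟨1⟩ ⊕ ⟨−1⟩` and Witt cancellation). No evenness of the form, no signature, no
  Hodge–Riemann positivity, no ample class, no marking, no period.
* `realMultiplicationSqrtTwoAlgebraic_of_twinSimilitude_of_even_betti` — the route decl BY NAME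
  from X and "`b₂(S)` is even for every projective K3 surface `S`";
* `realMultiplicationSqrtTwoAlgebraic_of_twinSimilitude_of_b2` — the route decl from X and the ONE
  named numerical fact `K3_finrank_complexBetti_two` (`b₂ = 22`, Huybrechts Ch. 1 §3.3; Noether's
  formula), superseding `…_of_k3Invariants` (three facts) and `…_of_marking`;
* `realMultiplicationGlue_of_b2`, `assembly_of_squareGlue_of_b2` — the same census for the glue item
  `RealMultiplicationGlue` (stmt-HodgeConjecture-13681) and the frame item `Assembly`
  (stmt-HodgeConjecture-13942, granted `SquareGlue`).

Parity is also NECESSARY on this line: for odd `b₂` the rational quadratic space `H²(S, ℚ)` is not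
similar to itself with multiplier `2` (discriminants differ by the non-square `2`), so X at `(S, S)`
is then vacuous for multiplier `2`. So, as of this file: item stmt-HodgeConjecture-13679 = X (open
problem) + `b₂(K3) = 22` (one capped, printed, purely numerical fact; only its parity is used).
Everything here is proved; no definition and no named fact is introduced.
Prover seat prover-pitem-stmt-HodgeConjecture-13679-c3-0.

## References

* [Varesco2023] M. Varesco, Math. Z. 305 (2023), Thm. 2.1, Rem. 2.2.
* [Huybrechts2016K3] D. Huybrechts, *Lectures on K3 Surfaces*, CUP 2016, Ch. 1 §3.3 (p. 24:
  `b₂(X) = 22`), Prop. 3.5.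
* [Serre1973] J.-P. Serre, *A Course in Arithmetic*, Ch. V §2.2 Thm. 4.
* [VanGeemenSchuett2023] B. van Geemen, M. Schütt, arXiv:2310.05196, Rem. 4.9.
-/

noncomputable section

namespace Summit.HodgeConjecture.HodgeConjecture.Theorems.NikulinTwinTransport

open scoped Manifold
open CategoryTheory Module
open Literature.AlgebraicGeometry Literature.AlgebraicGeometry.Motives
open Literature.AlgebraicGeometry.HodgeTheory Literature.AlgebraicGeometry.Surfaces
open Literature.AlgebraicTopology.SingularHomology

variable {S : SchemeOver ℂ}

/-! ### `H²(S, ℚ)(2) ≅ H²(S, ℚ)` for every smooth projective surface with even `b₂` -/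

/-- **A rational `2`-self-similitude of `(H²(S(ℂ); ℂ), ∪)` from the parity of `b₂`.** For `S`
smooth projective of dimension `2` over `ℂ` with `dim_ℂ H²(S(ℂ); ℂ)` even there is a `ℂ`-linear
`Ξ` of `H²(S(ℂ); ℂ)` preserving rational classes with `(Ξx ∪ Ξy) = 2 (x ∪ y)`: in an integral
marking `η` with symmetric unimodular Gram matrix `G` (`exists_integralMarking`), `Ξ = η⁻¹ A η`
for the rational `A` with `Aᵀ G A = 2G` of `exists_ratMatrix_twoSimilitude` (Serre Ch. V Thm. 4 +
Witt). The hypothesis `K3TwoSelfSimilar` of the marking-free glue thus holds for every projective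
K3 surface as soon as `b₂` is even. [cite: Serre1973, Ch. V §2.2 Thm. 4]
[cite: Huybrechts2016K3, Ch. 1 §3.2–3.3 (p. 22–24)] -/
theorem twoSelfSimilar_of_even_finrank (hS : IsSmoothProjective 2 S)
    (hev : Even (Module.finrank ℂ (complexBetti S (2 * 1)))) :
    ∃ Ξ : complexBetti S (2 * 1) →ₗ[ℂ] complexBetti S (2 * 1),
      (∀ x, IsRationalClass x → IsRationalClass (Ξ x)) ∧
      ∀ x y : complexBetti S (2 * 1), cupProduct (rfl : 2 * 1 + 2 * 1 = 2 * 2) (Ξ x) (Ξ y) =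
        (2 : ℂ) • cupProduct (rfl : 2 * 1 + 2 * 1 = 2 * 2) x y := by
  obtain ⟨n, η, G, p, -, -, -, hGt, hGdet, hηint, hηcup⟩ := exists_integralMarking hS
  -- `n = b₂` is even
  have hn : Even n := by
    have h := η.finrank_eq
    rw [Module.finrank_fin_fun] at h
    rw [← h]
    exact hev
  obtain ⟨A, hA⟩ := exists_ratMatrix_twoSimilitude G hGt hGdet (by simpa using hn)
  -- the rational `2`-similitude `ξ = A` of `(ℚⁿ, G)` and its complexification `M`
  set ξ : Module.End ℚ (Fin n → ℚ) := Matrix.toLin' A with hξ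
  set M : Module.End ℂ (Fin n → ℂ) := Matrix.toLin' (A.map (Rat.cast : ℚ → ℂ)) with hM
  have hMξ : ∀ u : Fin n → ℚ, M (fun i => (u i : ℂ)) = fun i => (ξ u i : ℂ) := fun u => by
    funext i
    simp only [hM, hξ, Matrix.toLin'_apply, Matrix.mulVec, dotProduct, Matrix.map_apply, Rat.cast_sum,
      Rat.cast_mul]
  have hξ2 : ∀ u v, Matrix.toBilin' (G.map (Int.cast : ℤ → ℚ)) (ξ u) (ξ v) =
      2 * Matrix.toBilin' (G.map (Int.cast : ℤ → ℚ)) u v := fun u v => by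
    rw [hξ, ← LinearMap.BilinForm.comp_apply, Matrix.toBilin'_comp, hA, map_smul, LinearMap.smul_apply,
      LinearMap.smul_apply, smul_eq_mul]
  have hM2 := toBilin'_of_ratRestriction G M ξ hMξ 2 hξ2
  refine ⟨η.symm.toLinearMap ∘ₗ M ∘ₗ η.toLinearMap, fun x hx => ?_, fun x y => ?_⟩
  · obtain ⟨w, hw⟩ := (isRationalClass_iff_of_integralMarking hS η hηint x).1 hx
    refine (isRationalClass_iff_of_integralMarking hS η hηint _).2 ⟨ξ w, ?_⟩
    simp only [LinearMap.coe_comp, LinearEquiv.coe_coe, Function.comp_apply, hw, hMξ w,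
      LinearEquiv.apply_symm_apply]
  · simp only [LinearMap.coe_comp, LinearEquiv.coe_coe, Function.comp_apply]
    rw [hηcup, hηcup, LinearEquiv.apply_symm_apply, LinearEquiv.apply_symm_apply, hM2, Rat.cast_ofNat,
      smul_smul]

/-- **`K3TwoSelfSimilar` from `b₂ = 22`**: under the named fact `K3_finrank_complexBetti_two`
every K3 surface carries a rational `2`-self-similitude of `(H²(S(ℂ); ℂ), ∪)` (only the parity of
`22` is used). Supersedes `k3TwoSelfSimilar_of_marking` and `twoSelfSimilar_of_invariants` as the
source of that hypothesis. [cite: Huybrechts2016K3, Ch. 1 §3.3 p. 24 (b₂(X) = 22)] -/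
theorem k3TwoSelfSimilar_of_b2 (h22 : K3_finrank_complexBetti_two)
    (S : SchemeOver ℂ) (hS : IsK3Surface S) :
    ∃ Ξ : complexBetti S (2 * 1) →ₗ[ℂ] complexBetti S (2 * 1),
      (∀ x, IsRationalClass x → IsRationalClass (Ξ x)) ∧
      ∀ x y : complexBetti S (2 * 1), cupProduct (rfl : 2 * 1 + 2 * 1 = 2 * 2) (Ξ x) (Ξ y) =
        (2 : ℂ) • cupProduct (rfl : 2 * 1 + 2 * 1 = 2 * 2) x y :=
  twoSelfSimilar_of_even_finrank hS.1 (by rw [h22 S hS]; exact ⟨11, rfl⟩)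

/-! ### The route decls from X and the parity of `b₂` / from X and `b₂ = 22` -/

/-- **`RealMultiplicationSqrtTwoAlgebraic` (item stmt-HodgeConjecture-13679) from X = Sim₂(K3) and
the parity of `b₂`**: real multiplication by `√2` on a projective K3 surface is algebraic granted X
(at the pairs `(S, S)`) and "`dim_ℂ H²(S(ℂ); ℂ)` is even for every projective K3 surface `S`" — the
X-line's exact topological input (`twoSelfSimilar_of_even_finrank` fed to
`realMultiplicationSqrtTwoAlgebraic_of_twinSimilitude_of_twoSelfSimilar`).
[cite: Varesco2023, Thm. 2.1 and Rem. 2.2] [cite: Serre1973, Ch. V §2.2 Thm. 4] -/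
theorem realMultiplicationSqrtTwoAlgebraic_of_twinSimilitude_of_even_betti
    (hX : Theses.NikulinTwinTransport.TwinSimilitudeAlgebraic)
    (hev : ∀ S : SchemeOver ℂ, IsK3Surface S → Even (Module.finrank ℂ (complexBetti S (2 * 1)))) :
    Theses.NikulinTwinTransport.RealMultiplicationSqrtTwoAlgebraic :=
  realMultiplicationSqrtTwoAlgebraic_of_twinSimilitude_of_twoSelfSimilar hX
    fun S hS => twoSelfSimilar_of_even_finrank hS.1 (hev S hS)

/-- **`RealMultiplicationSqrtTwoAlgebraic` (item stmt-HodgeConjecture-13679) from X = Sim₂(K3) and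
the ONE named numerical fact `b₂(K3) = 22`** (`K3_finrank_complexBetti_two`, Huybrechts Ch. 1 §3.3;
Noether's formula and `e = c₂ = 24`). Supersedes the closing forms
`realMultiplicationSqrtTwoAlgebraic_of_twinSimilitude_of_k3Invariants` (three numerical facts) and
`…_of_twinSimilitude_of_marking` (the marking fact): the evenness of the intersection form, its
index, the Hodge–Riemann positivity and the ample class are not needed.
[cite: Varesco2023, Thm. 2.1 and Rem. 2.2] [cite: Huybrechts2016K3, Ch. 1 §3.3 p. 24 (b₂(X) = 22)] -/
theorem realMultiplicationSqrtTwoAlgebraic_of_twinSimilitude_of_b2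
    (hX : Theses.NikulinTwinTransport.TwinSimilitudeAlgebraic) (h22 : K3_finrank_complexBetti_two) :
    Theses.NikulinTwinTransport.RealMultiplicationSqrtTwoAlgebraic :=
  realMultiplicationSqrtTwoAlgebraic_of_twinSimilitude_of_twoSelfSimilar hX (k3TwoSelfSimilar_of_b2 h22)

/-- **The glue item `RealMultiplicationGlue` (stmt-HodgeConjecture-13681, `TwinSimilitudeAlgebraic →
HodgeIsometryAlgebraic → TwinExists → LefschetzOneOneK3 → RealMultiplicationSqrtTwoAlgebraic`) from
the ONE named fact `b₂(K3) = 22`** (through `realMultiplicationGlue_of_twoSelfSimilar`: of the glue's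
hypotheses X and Lefschetz `(1,1)` are used). [cite: Varesco2023, Thm. 2.1 and Rem. 2.2]
[cite: Huybrechts2016K3, Ch. 1 §3.3 p. 24 (b₂(X) = 22)] -/
theorem realMultiplicationGlue_of_b2 (h22 : K3_finrank_complexBetti_two) :
    Theses.NikulinTwinTransport.RealMultiplicationGlue :=
  realMultiplicationGlue_of_twoSelfSimilar (k3TwoSelfSimilar_of_b2 h22)

/-- **The frame item `Assembly` (stmt-HodgeConjecture-13942) from `SquareGlue` and the ONE named fact
`b₂(K3) = 22`** (through `assembly_of_squareGlue_of_twoSelfSimilar`).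
[cite: Varesco2023, Thm. 2.1 and Rem. 2.2] [cite: Huybrechts2016K3, Ch. 1 §3.3 p. 24 (b₂(X) = 22)] -/
theorem assembly_of_squareGlue_of_b2 (hSq : Theses.NikulinTwinTransport.SquareGlue)
    (h22 : K3_finrank_complexBetti_two) :
    Theses.NikulinTwinTransport.Assembly :=
  assembly_of_squareGlue_of_twoSelfSimilar hSq (k3TwoSelfSimilar_of_b2 h22)

end Summit.HodgeConjecture.HodgeConjecture.Theorems.NikulinTwinTransport

end
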